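import Summits.HodgeConjecture.HodgeConjecture.Theorems.VHCAbelianSchemesRoadExtJumpLocusLinearisedTwist
import Literature.AlgebraicGeometry.AbelianVarieties.LineBundleTensorPower
import HarnessLib

/-!
# Road №4 (`VHCAbelianSchemesRoad`), crux stmt-HodgeConjecture-26512 `DiagLocalOfMarkmanPinnedForall` — route «2T», step (i) in print's LITERAL twist:
# THE DESCENT TWIST `N = (D^{⊗a})^∨ = D^{−a}` DIES ON `P[2]` FOR `a` EVEN

research route conditional on HC_CM; not a corollary; Q11.4-sentence-2 already refuted in dim ≥ 3.

Seat prover-26512-2T-i g0 (director-hodge g18 R18.15 (i): «(B) §2 gives you 2T (ii)'s LITERAL twist today»; claim-free; `--supports stmt-HodgeConjecture-26512 --as helper`;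
the file `Theorems/VHCAbelianSchemesRoadExtJumpLocusLinearisedTwist.lean` is full at 399 l., hence this sibling). PENCIL-26512-TWOTORSION §2 (ii) with the twist
written as in print — `q^*Ē_a ≅ 𝓔 ⊗ D^{−a}`, `D = det 𝓔` (Markman, Rem. 9.3.7, Lemma 9.3.5), `D^{−a} = (D^{⊗a})^∨` — over typer-26512-m4 g1's
`Literature/AlgebraicGeometry/AbelianVarieties/LineBundleTensorPower.lean` (p685851: `isFiniteLocallyFree_tensorPow`, `hasRank_tensorPow_one`, `hasRank_dual`,
`detClass_dual_tensorPow : [(M^{⊗n})^∨] = [M]^{−n}`) and §7 of the sibling (`mem_extJumpLocus_tensor_iff_of_mem_torsionPoints_of_isFiniteLocallyFree`: 01CD is the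
tree theorem `Modules.pullbackTensorIso` on vector-bundle terms; `τ_x^*N ≅ N` by the theorem of the square):

* `mem_extJumpLocus_dualTensorPow_tensor_iff_of_mem_torsionPoints` — `D` rank one, `m ∣ a`, `x ∈ A[m](ℂ)`, `E•` with finite locally free terms:
  `x ∈ J((D^{⊗a})^∨ ⊗ E•) ↔ x ∈ J(E•)`, granted `(D^{⊗a})^∨ ⊗ –` is an equivalence (the ONE displayed input, Stacks 0B8M);
* `mem_extJumpLocus_dualTensorPow_tensor_iff_of_two_torsion` — the case of the memo: `a` EVEN, `x` a TWO-TORSION point;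
* `…_of_invertibleFact` — the same under the named fact `Modules.LocallyFreeRankOneIsInvertible` (Tag 0B8M) BY NAME;
* `not_mem_extJumpLocus_quotientPullback_of_quasiIso_dualTensorPow_twist` — the shape (N-U♭) consumes: on `P = J × Ĵ`, a quasi-isomorphism
  `q^*E• ⟶ (D^{⊗a})^∨ ⊗ 𝓔` with `𝓔` a bounded vector-bundle complex, `a` even, `p ∈ P[2](ℂ)`, `p ∉ J(𝓔)` ⟹ `p ∉ J(q^*E•)`, CONDITIONAL on the ONE named fact.
* §2 (APPEND) the primed UNCONDITIONAL forms — 0B8M became the tree theorem `LocallyFreeRankOneIsInvertible_holds` (typer-26512-m4 g1): no named fact remains in 2T step (i).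

NOTHING here says (N-U♭), (N-U), (S4), the crux, №4, HC_AV, HC_CM or HC holds; HC_CM HELD, by name only; helper lane (width toward the crux = 0).
References: [cite: Markman2025SecantWeil, §9.3 Rem. 9.3.7 and Lemma 9.3.5] [cite: Lange2023AbelianVarietiesC, Thm. 1.3.5 and Prop. 1.4.6 (b)] [cite: StacksProject, Tag 0B8M and Tag 01CD]
[cite: Hartshorne1977, II Prop. 6.12 and Ex. 6.11] [cite: Mukai1978, §3].
-/

noncomputable section

-- `TopCat.Presheaf`/`Scheme.Modules` are not reducible (as in Mathlib's `AlgebraicGeometry/Modules/Sheaf.lean`).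
set_option backward.isDefEq.respectTransparency false

open CategoryTheory CategoryTheory.Category CategoryTheory.Limits AlgebraicGeometry

namespace Summit.HodgeConjecture.HodgeConjecture.Ring2.SemiregularRepresentatives

set_option linter.dupNamespace false -- the cell's namespace repeats the summit name, as in every `Ring2*` file

namespace NowhereDisplaceable

open Literature.AlgebraicGeometry Literature.AlgebraicGeometry.Motives Literature.AlgebraicGeometry.Motives.AbelianVariety
open Literature.AlgebraicGeometry.Modules Literature.AlgebraicGeometry.AbelianVarieties
open Summit.HodgeConjecture.HodgeConjecture.Ring2.SemiregularRepresentatives.MoverTrap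

/-- **2T STEP (i), LITERAL TWIST `N = (D^{⊗a})^∨`**: for `D` of rank one on the complex abelian variety `A`, `m ∣ a`, `x ∈ A[m](ℂ)` and a cochain complex `E•` with finite
locally free terms, `x ∈ J((D^{⊗a})^∨ ⊗ E•) ↔ x ∈ J(E•)` — granted that `(D^{⊗a})^∨ ⊗ –` is an equivalence of `Mod(𝒪_A)` (Stacks 0B8M, the one displayed input). `[(D^{⊗a})^∨] = [D]^{−a}`
(`detClass_dual_tensorPow`), so §7 of the sibling applies with `γ = [D]`, `n = −a`. [cite: Markman2025SecantWeil, §9.3 Rem. 9.3.7 and Lemma 9.3.5]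
[cite: Lange2023AbelianVarietiesC, Thm. 1.3.5 and Prop. 1.4.6 (b)] [cite: StacksProject, Tag 0B8M and Tag 01CD] -/
theorem mem_extJumpLocus_dualTensorPow_tensor_iff_of_mem_torsionPoints (A : AbelianVariety ℂ) {D : A.X.left.Modules} (hD : HasRank D 1) {m : ℤ} {a : ℕ}
    (hma : m ∣ (a : ℤ)) {x : A.Points ℂ} (hx : x ∈ A.torsionPoints ℂ m)
    [((tensorBifunctor A.X.left).obj (Modules.dual (tensorPow D a))).IsEquivalence]
    (E : CochainComplex A.X.left.Modules ℤ) (hE : ∀ i, IsFiniteLocallyFree (E.X i)) :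
    haveI := preservesZeroMorphisms_tensorBifunctor_obj (Modules.dual (tensorPow D a))
    x ∈ extJumpLocus A ((((tensorBifunctor A.X.left).obj (Modules.dual (tensorPow D a))).mapHomologicalComplex (ComplexShape.up ℤ)).obj E) ↔
      x ∈ extJumpLocus A E :=
  mem_extJumpLocus_tensor_iff_of_mem_torsionPoints_of_isFiniteLocallyFree A
    (isFiniteLocallyFree_dual (isFiniteLocallyFree_tensorPow (HasRank.isFiniteLocallyFree' hD) a)) (hasRank_dual (hasRank_tensorPow_one hD a))
    (dvd_neg.2 hma) (detClass_dual_tensorPow hD (HasRank.isFiniteLocallyFree' hD) a _) hx E hE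

/-- **THE CASE OF THE MEMO: `a` EVEN, `x` TWO-TORSION** — `x ∈ A[2](ℂ)`, `2 ∣ a`: `x ∈ J((D^{⊗a})^∨ ⊗ E•) ↔ x ∈ J(E•)` for `E•` with finite locally free terms,
granted `(D^{⊗a})^∨ ⊗ –` is an equivalence (Stacks 0B8M) — «the descent twist `D^{−a′}` is invisible at two-torsion points for `a′` even» (PENCIL-26512-TWOTORSION
§2 (ii); print: `(d, a′) = (6, 8)`, or `(4, 2)`). [cite: Markman2025SecantWeil, §9.3 Rem. 9.3.7 and Lemma 9.3.5] [cite: Lange2023AbelianVarietiesC, Thm. 1.3.5 and Prop. 1.4.6 (b)] -/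
theorem mem_extJumpLocus_dualTensorPow_tensor_iff_of_two_torsion (A : AbelianVariety ℂ) {D : A.X.left.Modules} (hD : HasRank D 1) {a : ℕ} (ha : Even a)
    {x : A.Points ℂ} (hx : x ∈ A.torsionPoints ℂ 2) [((tensorBifunctor A.X.left).obj (Modules.dual (tensorPow D a))).IsEquivalence]
    (E : CochainComplex A.X.left.Modules ℤ) (hE : ∀ i, IsFiniteLocallyFree (E.X i)) :
    haveI := preservesZeroMorphisms_tensorBifunctor_obj (Modules.dual (tensorPow D a))
    x ∈ extJumpLocus A ((((tensorBifunctor A.X.left).obj (Modules.dual (tensorPow D a))).mapHomologicalComplex (ComplexShape.up ℤ)).obj E) ↔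
      x ∈ extJumpLocus A E :=
  mem_extJumpLocus_dualTensorPow_tensor_iff_of_mem_torsionPoints A hD (Int.natCast_dvd_natCast.2 (even_iff_two_dvd.1 ha)) hx E hE

/-- **The same under the ONE named fact `Modules.LocallyFreeRankOneIsInvertible` (Stacks 0B8M) BY NAME**, CONDITIONAL on that name only: `D` rank one, `a` even,
`x ∈ A[2](ℂ)`, `E•` with finite locally free terms ⟹ `x ∈ J((D^{⊗a})^∨ ⊗ E•) ↔ x ∈ J(E•)`. [cite: StacksProject, Tag 0B8M (Modules, Lemma 17.25.4)]
[cite: Markman2025SecantWeil, §9.3 Rem. 9.3.7 and Lemma 9.3.5] -/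
theorem mem_extJumpLocus_dualTensorPow_tensor_iff_of_two_torsion_of_invertibleFact (hInv : LocallyFreeRankOneIsInvertible.{0}) (A : AbelianVariety ℂ)
    {D : A.X.left.Modules} (hD : HasRank D 1) {a : ℕ} (ha : Even a) {x : A.Points ℂ} (hx : x ∈ A.torsionPoints ℂ 2)
    (E : CochainComplex A.X.left.Modules ℤ) (hE : ∀ i, IsFiniteLocallyFree (E.X i)) :
    haveI := preservesZeroMorphisms_tensorBifunctor_obj (Modules.dual (tensorPow D a))
    x ∈ extJumpLocus A ((((tensorBifunctor A.X.left).obj (Modules.dual (tensorPow D a))).mapHomologicalComplex (ComplexShape.up ℤ)).obj E) ↔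
      x ∈ extJumpLocus A E := by
  haveI : ((tensorBifunctor A.X.left).obj (Modules.dual (tensorPow D a))).IsEquivalence :=
    (hInv _ (isFiniteLocallyFree_dual (isFiniteLocallyFree_tensorPow (HasRank.isFiniteLocallyFree' hD) a)) (hasRank_dual (hasRank_tensorPow_one hD a))).isEquivalence
  exact mem_extJumpLocus_dualTensorPow_tensor_iff_of_two_torsion A hD ha hx E hE

/-- **The shape (N-U♭) consumes, print's literal twist, under the ONE named fact** (Stacks 0B8M): on `P = J × Ĵ` of a secant–quotient datum, for a bounded vector-bundle
complex `𝓔`, `D` of rank one (print: `D = det 𝓔`), `a` even and a quasi-isomorphism `q^*E• ⟶ (D^{⊗a})^∨ ⊗ 𝓔` (print: `q^*Ē_a ≅ 𝓔 ⊗ D^{−a}`, Rem. 9.3.7), every two-torsion point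
`p ∈ P[2](ℂ)` which does not jump for `𝓔` does not jump for `q^*E•`. CONDITIONAL on `Modules.LocallyFreeRankOneIsInvertible` and on nothing else.
[cite: Markman2025SecantWeil, §9.3 Rem. 9.3.7 and Lemma 9.3.5] [cite: StacksProject, Tag 0B8M (Modules, Lemma 17.25.4)] -/
theorem not_mem_extJumpLocus_quotientPullback_of_quasiIso_dualTensorPow_twist (hInv : LocallyFreeRankOneIsInvertible.{0}) (D : SecantQuotientDatum)
    (E : CochainComplex D.Y.X.left.Modules ℤ) {L : D.P.X.left.Modules} (hL : HasRank L 1) {a : ℕ} (ha : Even a) {p : D.P.Points ℂ} (hp : p ∈ D.P.torsionPoints ℂ 2)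
    (𝓔 : CochainComplex D.P.X.left.Modules ℤ) (h𝓔vb : KTheory.IsBoundedVBComplex 𝓔)
    (f : haveI := preservesZeroMorphisms_tensorBifunctor_obj (Modules.dual (tensorPow L a))
      quotientPullbackComplex D E ⟶ (((tensorBifunctor D.P.X.left).obj (Modules.dual (tensorPow L a))).mapHomologicalComplex (ComplexShape.up ℤ)).obj 𝓔)
    (hf : haveI := preservesZeroMorphisms_tensorBifunctor_obj (Modules.dual (tensorPow L a)); QuasiIso f) (h𝓔 : p ∉ extJumpLocus D.P 𝓔) :
    p ∉ extJumpLocus D.P (quotientPullbackComplex D E) :=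
  not_mem_extJumpLocus_quotientPullback_of_quasiIso_tensor_of_isBoundedVBComplex hInv D E
    (isFiniteLocallyFree_dual (isFiniteLocallyFree_tensorPow (HasRank.isFiniteLocallyFree' hL) a)) (hasRank_dual (hasRank_tensorPow_one hL a))
    (dvd_neg.2 (Int.natCast_dvd_natCast.2 (even_iff_two_dvd.1 ha))) (detClass_dual_tensorPow hL (HasRank.isFiniteLocallyFree' hL) a _) hp 𝓔 h𝓔vb f hf h𝓔

/-! ## §2 (APPEND, same seat) UNCONDITIONAL FORMS — Stacks 0B8M is now a tree THEOREM (`Modules.LocallyFreeRankOneIsInvertible_holds`, typer-26512-m4 g1,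
`Modules/InvertibleOfRankOne` + `Modules/InvertibleModule`; Stacks 01CD on vector-bundle terms = `Modules.pullbackTensorIso`, typer-26512-m2): 2T step (i) for vector-bundle
carriers carries NO displayed input and NO named fact. -/

/-- **2T STEP (i), UNCONDITIONAL**: `N` finite locally free of rank one on a complex abelian variety `A` with `[det N] = γⁿ`, `x ∈ A[m](ℂ)`, `m ∣ n`, `E•` a cochain complex with
finite locally free terms ⟹ `x ∈ J(N ⊗ E•) ↔ x ∈ J(E•)`. No hypothesis beyond these: `N ⊗ –` is an equivalence by `LocallyFreeRankOneIsInvertible_holds`, `τ_x^*(N ⊗ Eⁱ) ≅ τ_x^*N ⊗ τ_x^*Eⁱ`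
by `pullbackTensorIso`, `τ_x^*N ≅ N` by the theorem of the square. [cite: Markman2025SecantWeil, §9.3 Rem. 9.3.7 and Lemma 9.3.5] [cite: Lange2023AbelianVarietiesC, Thm. 1.3.5 and Prop. 1.4.6 (b)]
[cite: StacksProject, Tag 0B8M and Tag 01CD] -/
theorem mem_extJumpLocus_tensor_iff_of_mem_torsionPoints' (A : AbelianVariety ℂ) {N : A.X.left.Modules} (hN : IsFiniteLocallyFree N) (h₁ : HasRank N 1)
    {γ : CechPic A.X.left} {m n : ℤ} (hmn : m ∣ n) (hγ : detClass hN = γ ^ n) {x : A.Points ℂ} (hx : x ∈ A.torsionPoints ℂ m)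
    (E : CochainComplex A.X.left.Modules ℤ) (hE : ∀ i, IsFiniteLocallyFree (E.X i)) :
    haveI := preservesZeroMorphisms_tensorBifunctor_obj N
    x ∈ extJumpLocus A ((((tensorBifunctor A.X.left).obj N).mapHomologicalComplex (ComplexShape.up ℤ)).obj E) ↔ x ∈ extJumpLocus A E :=
  mem_extJumpLocus_tensor_iff_of_mem_torsionPoints_of_invertibleFact LocallyFreeRankOneIsInvertible_holds A hN h₁ hmn hγ hx E hE

/-- **THE MEMO'S CASE, UNCONDITIONAL**: `D` rank one, `a` even, `x ∈ A[2](ℂ)`, `E•` with finite locally free terms ⟹ `x ∈ J((D^{⊗a})^∨ ⊗ E•) ↔ x ∈ J(E•)` — «the descent twist `D^{−a′}`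
is invisible at two-torsion points for `a′` even», PENCIL-26512-TWOTORSION §2 (ii), with no displayed input. [cite: Markman2025SecantWeil, §9.3 Rem. 9.3.7 and Lemma 9.3.5]
[cite: Lange2023AbelianVarietiesC, Thm. 1.3.5 and Prop. 1.4.6 (b)] -/
theorem mem_extJumpLocus_dualTensorPow_tensor_iff_of_two_torsion' (A : AbelianVariety ℂ) {D : A.X.left.Modules} (hD : HasRank D 1) {a : ℕ} (ha : Even a)
    {x : A.Points ℂ} (hx : x ∈ A.torsionPoints ℂ 2) (E : CochainComplex A.X.left.Modules ℤ) (hE : ∀ i, IsFiniteLocallyFree (E.X i)) :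
    haveI := preservesZeroMorphisms_tensorBifunctor_obj (Modules.dual (tensorPow D a))
    x ∈ extJumpLocus A ((((tensorBifunctor A.X.left).obj (Modules.dual (tensorPow D a))).mapHomologicalComplex (ComplexShape.up ℤ)).obj E) ↔
      x ∈ extJumpLocus A E :=
  mem_extJumpLocus_dualTensorPow_tensor_iff_of_two_torsion_of_invertibleFact LocallyFreeRankOneIsInvertible_holds A hD ha hx E hE

/-- **The shape (N-U♭) consumes, print's literal twist, UNCONDITIONAL in the twist**: on `P = J × Ĵ`, `𝓔` a bounded vector-bundle complex, `D` of rank one, `a` even, a quasi-isomorphism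
`q^*E• ⟶ (D^{⊗a})^∨ ⊗ 𝓔`, and a two-torsion point `p ∉ J(𝓔)` ⟹ `p ∉ J(q^*E•)`. No named fact. [cite: Markman2025SecantWeil, §9.3 Rem. 9.3.7 and Lemma 9.3.5] -/
theorem not_mem_extJumpLocus_quotientPullback_of_quasiIso_dualTensorPow_twist' (D : SecantQuotientDatum) (E : CochainComplex D.Y.X.left.Modules ℤ)
    {L : D.P.X.left.Modules} (hL : HasRank L 1) {a : ℕ} (ha : Even a) {p : D.P.Points ℂ} (hp : p ∈ D.P.torsionPoints ℂ 2)
    (𝓔 : CochainComplex D.P.X.left.Modules ℤ) (h𝓔vb : KTheory.IsBoundedVBComplex 𝓔)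
    (f : haveI := preservesZeroMorphisms_tensorBifunctor_obj (Modules.dual (tensorPow L a))
      quotientPullbackComplex D E ⟶ (((tensorBifunctor D.P.X.left).obj (Modules.dual (tensorPow L a))).mapHomologicalComplex (ComplexShape.up ℤ)).obj 𝓔)
    (hf : haveI := preservesZeroMorphisms_tensorBifunctor_obj (Modules.dual (tensorPow L a)); QuasiIso f) (h𝓔 : p ∉ extJumpLocus D.P 𝓔) :
    p ∉ extJumpLocus D.P (quotientPullbackComplex D E) :=
  not_mem_extJumpLocus_quotientPullback_of_quasiIso_dualTensorPow_twist LocallyFreeRankOneIsInvertible_holds D E hL ha hp 𝓔 h𝓔vb f hf h𝓔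

end NowhereDisplaceable

end Summit.HodgeConjecture.HodgeConjecture.Ring2.SemiregularRepresentatives

end
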